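import Summits.HodgeConjecture.CorCM.CyclicTimesPrimeCMTypes
import Mathlib.NumberTheory.Cyclotomic.Gal
import Mathlib.RingTheory.ZMod.UnitsCyclic
import HarnessLib

/-!
# CM fields with cyclic Galois group of order `2^{a+1} q`: the number-field theorem and `ℚ(ζ_p)`, `p - 1 = 2^{a+1} q`

COR-CM (cell `pub-hodgecm2`), binder seat b04 (gen 11), count-neutral; sequel of `CorCM/CyclicTimesPrimeCMTypes` (the
group-level character-sum theorem `sum_ne_zero_of_orderOf_eq_two_pow_mul_prime`).  KERNEL ONLY: theorems; no
definition, no named fact, no `sorry`.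

* §2 `separating_gal_of_isPrimitive` (Shimura's primitivity read on `Gal(K/ℚ)`), **`isNondegenerate_of_isPrimitive_of_isCyclic`**
  (CM field, normal, cyclic Galois group of order `2^{a+1} q`, `q` an odd prime ⟹ every PRIMITIVE CM type is
  nondegenerate, of rank `2^a q + 1`), `isNondegenerate_iff_isSimple_of_isCyclic`, and the Hodge conjecture for all
  powers of every SIMPLE abelian variety with CM by such a field (`hodgeConjectureFor_pow_of_isSimple_of_isCyclic`),
  UNCONDITIONALLY;
* §3 `ℚ(ζ_p)` for primes `p` with `p - 1 = 2^{a+1} q` (`7, 11, 13, 23, 29, 41, 47, 53, 59, 83, 89, 97, 107, 113, 137,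
  149, …`): `hodgeConjectureFor_pow_of_isSimple_of_prime`, `cmTypeRank_eq_of_isPrimitive_of_prime`; spelled out for
  `ℚ(ζ₁₃)` (the structural form of the kernel census `CyclotomicRankCensusThirteen`) and `ℚ(ζ₉₇)` (simple CM
  abelian varieties of dimension `48`).  Sharpness: `ℚ(ζ₁₉)` (`18 = 2·3²`), `ℚ(ζ₆₇)` (`66 = 2·3·11`) have primitive
  degenerate types (tree file `Pohlmann1968/DegenerateCMTypesRibetLenstraSerre`).

## References

* [Kubota1965] T. Kubota, Trans. AMS 118 (1965), §4 Lemma 2.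
* [Shimura1998] G. Shimura, *Abelian Varieties with Complex Multiplication and Modular Functions*, §8.1, §8.2 Prop. 26.
* [Gordon1999HodgeAVSurvey] B. B. Gordon, *A survey of the Hodge conjecture for abelian varieties*, Prop. 9.4.1, §9.4.2,
  Thm. 6.4.
* [Washington1997] L. C. Washington, *Introduction to Cyclotomic Fields*, Thm. 2.5.
-/

noncomputable section

open CategoryTheory CategoryTheory.Limits NumberField Polynomial

namespace Summit.HodgeConjecture.CorCM.CyclicTwoPower

open Literature.NumberTheory.ComplexMultiplication
open Literature.AlgebraicGeometry.Motives (AbelianVariety CMType)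
open Literature.AlgebraicGeometry.HodgeTheory
open Literature.AlgebraicGeometry.ComplexMultiplication (IsCMTypeRealisation isSimple_iff_isPrimitive)
open Literature.AlgebraicGeometry.VanGeemen1994 (hodgeClassSpan)
open Literature.Barriers.HodgeConjecture (divisorClassesSpan)
open Literature.AlgebraicGeometry.Pohlmann1968

/-! ### §2 CM fields with cyclic Galois group of order `2^{a+1} q` -/

section Field

variable {K : Type} [Field K] [NumberField K] [IsCMField K] [Normal ℚ K]

omit [IsCMField K] in
/-- **Primitivity read on the Galois group** (abelian case): if `Φ` is primitive at `φ₀` (Shimura §8.2 Prop. 26),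
two elements `x, y ∈ Gal(K/ℚ)` whose translates meet `{g | σ_g ∈ Φ}` in the same pattern are equal — `Aut(ℂ)` acts
on `σ_g = φ₀ ∘ g⁻¹` through `Gal(K/ℚ)` by translation. [cite: Shimura1998, §8.1, §8.2 Prop. 26] -/
theorem separating_gal_of_isPrimitive (hcomm : ∀ g h : K ≃ₐ[ℚ] K, g * h = h * g) (Φ : CMType K) (φ₀ : K →+* ℂ)
    (hprim : IsPrimitive (ℂ ≃+* ℂ) Φ.1 φ₀) (x y : K ≃ₐ[ℚ] K)
    (hxy : ∀ g : K ≃ₐ[ℚ] K, embOf φ₀ (g * x) ∈ Φ.1 ↔ embOf φ₀ (g * y) ∈ Φ.1) : x = y := by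
  haveI := isPretransitive_ringEquiv_complex (K := K)
  have hsep := (isPrimitive_iff_forall_eq _ φ₀).1 hprim (embOf φ₀ x) (embOf φ₀ y) fun τ => by
    obtain ⟨δ, hδ⟩ := exists_algEquiv_comp_eq_smul φ₀ τ
    rw [smul_embOf_of_comp φ₀ hδ, smul_embOf_of_comp φ₀ hδ, hcomm x, hcomm y]
    exact hxy δ⁻¹
  exact (embOf_bijective φ₀).1 hsep

/-- **Every PRIMITIVE CM type of a CM field with cyclic Galois group of order `2^{a+1} q`, `q` an odd prime, is
nondegenerate.** [cite: Kubota1965, §4 Lemma 2] [cite: Shimura1998, §8.2 Prop. 26] -/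
theorem isNondegenerate_of_isPrimitive_of_isCyclic (hcyc : IsCyclic (K ≃ₐ[ℚ] K)) {a q : ℕ} (hq : q.Prime)
    (hq2 : q ≠ 2) (hK : Module.finrank ℚ K = 2 ^ (a + 1) * q) (Φ : CMType K) (φ₀ : K →+* ℂ)
    (hprim : IsPrimitive (ℂ ≃+* ℂ) Φ.1 φ₀) : IsNondegenerate Φ := by
  classical
  obtain ⟨γ, hγgen⟩ := hcyc.exists_generator
  have hgen : ∀ x : K ≃ₐ[ℚ] K, x ∈ Submonoid.powers γ := fun x => mem_powers_iff_mem_zpowers.2 (hγgen x)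
  have hcomm : ∀ g h : K ≃ₐ[ℚ] K, g * h = h * g := fun g h => by
    obtain ⟨i, rfl⟩ := (Submonoid.mem_powers_iff _ _).1 (hgen g)
    obtain ⟨j, rfl⟩ := (Submonoid.mem_powers_iff _ _).1 (hgen h)
    rw [← pow_add, ← pow_add, add_comm]
  obtain ⟨ρ, hρ⟩ := exists_conj_gal (K := K)
  rw [isNondegenerate_iff_forall_oddCharacters hcomm Φ φ₀ ρ (hρ φ₀)]
  intro χ hχ
  have hcard : Fintype.card (K ≃ₐ[ℚ] K) = 2 ^ (a + 1) * q := by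
    rw [Fintype.card_congr (Equiv.ofBijective (embOf φ₀) (embOf_bijective φ₀)), NumberField.Embeddings.card, hK]
  have hγ : orderOf γ = 2 ^ (a + 1) * q := by
    rw [orderOf_eq_card_of_forall_mem_zpowers hγgen, Nat.card_eq_fintype_card, hcard]
  have hset : ({g : K ≃ₐ[ℚ] K | embOf φ₀ g ∈ Φ.1} : Set (K ≃ₐ[ℚ] K)) =
      ↑(Finset.univ.filter fun g : K ≃ₐ[ℚ] K => embOf φ₀ g ∈ Φ.1) := by
    ext g; simp
  have hcm := isCMTypeWith_gal hcomm Φ φ₀ ρ (hρ φ₀)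
  rw [hset] at hcm
  refine sum_ne_zero_of_orderOf_eq_two_pow_mul_prime hq hq2 hγ hgen hcm (fun x y hxy => ?_) χ hχ
  refine separating_gal_of_isPrimitive hcomm Φ φ₀ hprim x y fun g => ?_
  have := hxy g
  simpa only [Finset.mem_filter, Finset.mem_univ, true_and] using this

/-- … hence of Kubota rank `2^a q + 1`. [cite: Kubota1965, §4 Lemma 2] -/
theorem cmTypeRank_eq_of_isPrimitive_of_isCyclic (hcyc : IsCyclic (K ≃ₐ[ℚ] K)) {a q : ℕ} (hq : q.Prime)
    (hq2 : q ≠ 2) (hK : Module.finrank ℚ K = 2 ^ (a + 1) * q) (Φ : CMType K) (φ₀ : K →+* ℂ)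
    (hprim : IsPrimitive (ℂ ≃+* ℂ) Φ.1 φ₀) : cmTypeRank Φ = 2 ^ a * q + 1 := by
  have h := isNondegenerate_of_isPrimitive_of_isCyclic hcyc hq hq2 hK Φ φ₀ hprim
  have h2 : 2 ^ (a + 1) * q / 2 = 2 ^ a * q := by
    rw [pow_succ, mul_assoc, mul_comm 2 q, ← mul_assoc, Nat.mul_div_cancel _ two_pos]
  rw [isNondegenerate_iff, hK, h2] at h
  exact h

variable {Φ : CMType K} {A : AbelianVariety ℂ} {ι : 𝓞 K →+* End A} {θ : K →+* Module.End ℂ (complexBetti A.X 1)}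

/-- **Nondegenerate ⟺ simple realisation**, for CM fields with cyclic Galois group of order `2^{a+1} q`.
[cite: Shimura1998, §8.2 Prop. 26] [cite: Kubota1965, §2] -/
theorem isNondegenerate_iff_isSimple_of_isCyclic (hcyc : IsCyclic (K ≃ₐ[ℚ] K)) {a q : ℕ} (hq : q.Prime)
    (hq2 : q ≠ 2) (hK : Module.finrank ℚ K = 2 ^ (a + 1) * q) (hA : IsCMTypeRealisation Φ A ι θ) :
    IsNondegenerate Φ ↔ A.IsSimple := by
  obtain ⟨s₀⟩ := (inferInstance : Nonempty (K →+* ℂ))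
  rw [isSimple_iff_isPrimitive hA s₀]
  exact ⟨fun h => h.isPrimitive s₀, isNondegenerate_of_isPrimitive_of_isCyclic hcyc hq hq2 hK Φ s₀⟩

/-- **`Bᵐ(Aⁿ) ⊗ ℂ = Dᵐ(Aⁿ) ⊗ ℂ` on every power of every SIMPLE abelian variety with CM by a CM field with cyclic
Galois group of order `2^{a+1} q`.** [cite: Gordon1999HodgeAVSurvey, Thm. 6.4 and §9.3] -/
theorem hodgeClassSpan_pow_eq_divisorClassesSpan_of_isSimple_of_isCyclic (hcyc : IsCyclic (K ≃ₐ[ℚ] K)) {a q : ℕ}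
    (hq : q.Prime) (hq2 : q ≠ 2) (hK : Module.finrank ℚ K = 2 ^ (a + 1) * q) (hA : IsCMTypeRealisation Φ A ι θ)
    (hsimple : A.IsSimple) (n k : ℕ) :
    hodgeClassSpan (⨁ fun _ : Fin n => A).dim (⨁ fun _ : Fin n => A).X k =
      divisorClassesSpan (⨁ fun _ : Fin n => A).X (⨁ fun _ : Fin n => A).dim k :=
  ((isNondegenerate_iff_isSimple_of_isCyclic hcyc hq hq2 hK hA).2 hsimple).hodgeClassSpan_pow_eq_divisorClassesSpan
    hA n k

/-- **The Hodge conjecture for every power of every SIMPLE abelian variety with CM by a CM field with cyclic Galois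
group of order `2^{a+1} q`, `q` an odd prime** (`ℚ(ζ_p)` for every prime `p` with `p - 1 = 2^{a+1} q`) —
UNCONDITIONAL. [cite: Gordon1999HodgeAVSurvey, Thm. 6.4 and §9.3] [cite: Kubota1965, §4 Lemma 2] -/
theorem hodgeConjectureFor_pow_of_isSimple_of_isCyclic (hcyc : IsCyclic (K ≃ₐ[ℚ] K)) {a q : ℕ} (hq : q.Prime)
    (hq2 : q ≠ 2) (hK : Module.finrank ℚ K = 2 ^ (a + 1) * q) (hA : IsCMTypeRealisation Φ A ι θ)
    (hsimple : A.IsSimple) (n : ℕ) : HodgeConjectureFor (⨁ fun _ : Fin n => A).dim (⨁ fun _ : Fin n => A).X :=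
  ((isNondegenerate_iff_isSimple_of_isCyclic hcyc hq hq2 hK hA).2 hsimple).hodgeConjectureFor_pow hA n

/-- **The Hodge conjecture for every SIMPLE abelian variety with CM by a CM field with cyclic Galois group of
order `2^{a+1} q`** (`HodgeConjectureFor (2^a q) A.X`) — UNCONDITIONAL. [cite: Gordon1999HodgeAVSurvey, §9.3] -/
theorem hodgeConjectureFor_of_isSimple_of_isCyclic (hcyc : IsCyclic (K ≃ₐ[ℚ] K)) {a q : ℕ} (hq : q.Prime)
    (hq2 : q ≠ 2) (hK : Module.finrank ℚ K = 2 ^ (a + 1) * q) (hA : IsCMTypeRealisation Φ A ι θ)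
    (hsimple : A.IsSimple) : HodgeConjectureFor (2 ^ a * q) A.X := by
  have hdim : A.dim = 2 ^ a * q := by
    have h : A.dim = Module.finrank ℚ K / 2 := Literature.AlgebraicGeometry.Motives.schemeDim_eq_holds hA.1
    have h2 : 2 ^ (a + 1) * q / 2 = 2 ^ a * q := by
      rw [pow_succ, mul_assoc, mul_comm 2 q, ← mul_assoc, Nat.mul_div_cancel _ two_pos]
    rw [hK, h2] at h
    exact h
  rw [← hdim]
  exact ((isNondegenerate_iff_isSimple_of_isCyclic hcyc hq hq2 hK hA).2 hsimple).hodgeConjectureFor hA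

end Field

/-! ### §3 `ℚ(ζ_p)` for a prime `p` with `p - 1 = 2^{a+1} q`, `q` an odd prime -/

section Prime

/-- For a prime `p`: `ℚ(ζ_p)` is CM, normal, with cyclic Galois group of order `p - 1`. [cite: Washington1997, Thm. 2.5] -/
theorem cm_normal_cyclic_finrank_of_prime {p : ℕ} (hp : p.Prime) (h2 : 2 < p)
    (L : Type) [Field L] [NumberField L] [IsCyclotomicExtension {p} ℚ L] :
    IsCMField L ∧ Normal ℚ L ∧ IsCyclic (L ≃ₐ[ℚ] L) ∧ Module.finrank ℚ L = p - 1 := by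
  haveI : NeZero p := ⟨hp.ne_zero⟩
  have hirr : Irreducible (cyclotomic p ℚ) := cyclotomic.irreducible_rat hp.pos
  haveI := IsCyclotomicExtension.isGalois {p} ℚ L
  exact ⟨IsCyclotomicExtension.Rat.isCMField L (S := ({p} : Set ℕ)) ⟨p, rfl, h2⟩, inferInstance,
    (MulEquiv.isCyclic (IsCyclotomicExtension.autEquivPow L hirr)).2 (ZMod.isCyclic_units_prime hp),
    by rw [IsCyclotomicExtension.finrank L hirr, Nat.totient_prime hp]⟩

/-- **`ℚ(ζ_p)`, `p` prime with `p - 1 = 2^{a+1} q`, `q` an odd prime: the Hodge conjecture for every power of every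
SIMPLE abelian variety with CM by `ℚ(ζ_p)`** — UNCONDITIONAL (e.g. `p = 7, 11, 13, 23, 29, 41, 47, 53, 59, 83, 89,
97`). [cite: Gordon1999HodgeAVSurvey, Thm. 6.4 and §9.3] [cite: Kubota1965, §4 Lemma 2] -/
theorem hodgeConjectureFor_pow_of_isSimple_of_prime {p a q : ℕ} (hp : p.Prime) (hq : q.Prime) (hq2 : q ≠ 2)
    (hpaq : p - 1 = 2 ^ (a + 1) * q) {L : Type} [Field L] [NumberField L] [IsCyclotomicExtension {p} ℚ L]
    {Φ : CMType L} {A : AbelianVariety ℂ} {ι : 𝓞 L →+* End A} {θ : L →+* Module.End ℂ (complexBetti A.X 1)}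
    (hA : IsCMTypeRealisation Φ A ι θ) (hsimple : A.IsSimple) (n : ℕ) :
    HodgeConjectureFor (⨁ fun _ : Fin n => A).dim (⨁ fun _ : Fin n => A).X := by
  have h2 : 2 < p := by
    have : 2 ≤ 2 ^ (a + 1) * q := by
      have := hq.two_le; have := Nat.one_le_two_pow (n := a + 1); nlinarith
    omega
  obtain ⟨hcm, hno, hcyc, hK⟩ := cm_normal_cyclic_finrank_of_prime hp h2 L
  exact hodgeConjectureFor_pow_of_isSimple_of_isCyclic hcyc hq hq2 (hK.trans hpaq) hA hsimple n

/-- **Kubota rank of every primitive CM type of `ℚ(ζ_p)`, `p - 1 = 2^{a+1} q`: `2^a q + 1` (nondegenerate).**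
[cite: Kubota1965, §4 Lemma 2] -/
theorem cmTypeRank_eq_of_isPrimitive_of_prime {p a q : ℕ} (hp : p.Prime) (hq : q.Prime) (hq2 : q ≠ 2)
    (hpaq : p - 1 = 2 ^ (a + 1) * q) {L : Type} [Field L] [NumberField L] [IsCyclotomicExtension {p} ℚ L]
    (Φ : CMType L) (φ₀ : L →+* ℂ) (hprim : IsPrimitive (ℂ ≃+* ℂ) Φ.1 φ₀) :
    cmTypeRank Φ = 2 ^ a * q + 1 ∧ IsNondegenerate Φ := by
  have h2 : 2 < p := by
    have : 2 ≤ 2 ^ (a + 1) * q := by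
      have := hq.two_le; have := Nat.one_le_two_pow (n := a + 1); nlinarith
    omega
  obtain ⟨hcm, hno, hcyc, hK⟩ := cm_normal_cyclic_finrank_of_prime hp h2 L
  exact ⟨cmTypeRank_eq_of_isPrimitive_of_isCyclic hcyc hq hq2 (hK.trans hpaq) Φ φ₀ hprim,
    isNondegenerate_of_isPrimitive_of_isCyclic hcyc hq hq2 (hK.trans hpaq) Φ φ₀ hprim⟩

/-- **`ℚ(ζ₁₃)` (`12 = 2²·3`)**, structurally: the Hodge conjecture for every power of every simple abelian sixfold
with CM by `ℚ(ζ₁₃)` — the theorem behind the kernel census `CyclotomicRankCensusThirteen`. [cite: Kubota1965, §4 Lemma 2] -/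
theorem hodgeConjectureFor_pow_of_isSimple_thirteen' {L : Type} [Field L] [NumberField L]
    [IsCyclotomicExtension {13} ℚ L] {Φ : CMType L} {A : AbelianVariety ℂ} {ι : 𝓞 L →+* End A}
    {θ : L →+* Module.End ℂ (complexBetti A.X 1)} (hA : IsCMTypeRealisation Φ A ι θ) (hsimple : A.IsSimple)
    (n : ℕ) : HodgeConjectureFor (⨁ fun _ : Fin n => A).dim (⨁ fun _ : Fin n => A).X :=
  hodgeConjectureFor_pow_of_isSimple_of_prime (p := 13) (a := 1) (q := 3) (by norm_num) (by norm_num) (by norm_num)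
    (by norm_num) hA hsimple n

/-- **`ℚ(ζ₉₇)` (`96 = 2⁵·3`)**: the Hodge conjecture for every power of every simple abelian variety of dimension
`48` with CM by `ℚ(ζ₉₇)` — UNCONDITIONAL. [cite: Kubota1965, §4 Lemma 2] -/
theorem hodgeConjectureFor_pow_of_isSimple_ninetySeven {L : Type} [Field L] [NumberField L]
    [IsCyclotomicExtension {97} ℚ L] {Φ : CMType L} {A : AbelianVariety ℂ} {ι : 𝓞 L →+* End A}
    {θ : L →+* Module.End ℂ (complexBetti A.X 1)} (hA : IsCMTypeRealisation Φ A ι θ) (hsimple : A.IsSimple)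
    (n : ℕ) : HodgeConjectureFor (⨁ fun _ : Fin n => A).dim (⨁ fun _ : Fin n => A).X :=
  hodgeConjectureFor_pow_of_isSimple_of_prime (p := 97) (a := 4) (q := 3) (by norm_num) (by norm_num) (by norm_num)
    (by norm_num) hA hsimple n

end Prime

end Summit.HodgeConjecture.CorCM.CyclicTwoPower

end
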